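import Literature.Algebra.Homology.FreeComplexDualAcyclicTopSurjective
import Literature.Algebra.Homology.FreeComplexDoubleDualBaseChange
import Literature.Algebra.Homology.VanishingBaseChangeOfQuasiIso
import HarnessLib

/-!
# `h₂` and `dim_k H¹(k ⊗ K•) = dim_k 𝔪/𝔪²` for a strictly perfect complex of amplitude `[0, g+1]` base-changed to a local ring,
# from power-torsion of its cohomology ([MumfordAV1970] §13, wiring of ★ B1 + ★ B2∕(R1) + the entry point)

Layer `Literature/Algebra/Homology`, namespace `Literature.Algebra.Homology`.  THEOREMS ONLY (★ `FreeComplexDualAcyclicTopSurjective` (R1), ★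
`FreeComplexDoubleDualBaseChange` (entry point), ★ `AcyclicityLemmaRegularSequence` (B1), ★ `VanishingBaseChangeOfQuasiIso`, ★ `BaseChangeComplex`;
no definition, no named fact, no instance, no notation, no `sorry`).  Junction «(h₂-WIRING)» of the duality-free «H1-DIM any characteristic» cut
of the DUAL-S road (cell hodgecm-mathlib, B-p04 memo v4): everything ALGEBRAIC between the geometric inputs — a strictly perfect complex `K•`
over a ring `A₀` (finite projective terms, amplitude `[0, g+1]`, e.g. ★ `Relative.grothendieckComplex` of a `(g+1)`-member cover), a LOCAL
`A₀`-algebra `R` with a weakly regular sequence `rs` of length `≥ g`, and POWER-TORSION of all cocycles of `R ⊗_{A₀} K•` by every `r ∈ rs`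
(★ B4 + ★ J4: «the cohomology is supported at the closed point») — and the hypothesis `h₂ : Hom_R(R ⊗ K•, R)` exact at `-1` of the entry point.

* §1 `free_baseChangeComplex_X`, `subsingleton_baseChangeComplex_X_of_lt`, `subsingleton_baseChangeComplex_X_of_gt` — the terms of `R ⊗_{A₀} K•`
  (★ `baseChangeComplex R K`) are finite free over the local ring `R` and vanish where `K•` does.
* §2 **`surjective_baseChangeComplex_d_of_quasiIso`** — if `K• → C•` is a quasi-isomorphism to a complex of FLAT modules vanishing above `g`
  (the Čech complex of the `(g+1)`-member cover), then `d^g ⊗ R : R ⊗ K^g → R ⊗ K^{g+1}` is onto for every `A₀`-algebra `R`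
  (`H^{g+1}(R ⊗ K•) = H^{g+1}(R ⊗ C•) = 0` by ★ `quasiIso_tensorLeft_map_of_flat`, and `K^{g+2} = 0`).
* §3 **`homComplex_baseChangeComplex_exactAt_of_torsion`** — `Hom_R(R ⊗ K•, R)` is exact at every `-g ≤ p < 0`: ★ B1
  `exactAt_of_isWeaklyRegular_of_flat_of_locallyNilpotent` makes `R ⊗ K•` exact below `g`, and ★ (R1) `homComplex_exactAt_of_surjective_d_top`
  dualises.
* §4 **`finrank_HOne_baseChangeComplex_residueField_eq_of_torsion`** — with the degree-`≤ 1` data `(ε, hε, h₁)` of ★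
  `exists_residueField_surjective_exact_lcomp_baseChange_grothendieckComplex` and `g ≥ 1`: `dim_k H¹(k ⊗_R (R ⊗_{A₀} K•)) = dim_k 𝔪_R/𝔪_R²`
  (the entry point ★ `finrank_HOne_baseChangeComplex_residueField_eq_finrank_cotangentSpace`); `= g` when `R` is regular of dimension `g`.

HC_CM is proved only modulo the 7 printed citations until rung 0 closes; this file discharges none of them (count-neutral capital).

## References
* [MumfordAV1970] D. Mumford, *Abelian Varieties* (1970), §13 (pp. 125–130); §5 Lemma 2 (p. 49).
* [PeskineSzpiro1973] C. Peskine, L. Szpiro, *Dimension projective finie et cohomologie locale*, Publ. Math. IHÉS 42 (1973), Lemme (1.8).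
* [BrunsHerzog1998] W. Bruns, J. Herzog, *Cohen–Macaulay rings*, rev. ed. (1998), §1.1 (p. 4), §1.3 (pp. 16–17).
* [Weibel1994] C. Weibel, *An introduction to homological algebra* (1994), 1.2.7 (p. 9).
-/

universe u

open CategoryTheory CategoryTheory.Limits CategoryTheory.MonoidalCategory HomologicalComplex RingTheory.Sequence TensorProduct
  IsLocalRing

noncomputable section

namespace Literature.Algebra.Homology

variable {A₀ : Type u} [CommRing A₀] (R : Type u) [CommRing R] [Algebra A₀ R] (K : CochainComplex (ModuleCat.{u} A₀) ℤ)

/-! ## §1 The terms of `R ⊗_{A₀} K•` -/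

/-- The terms of `R ⊗ K•` are finite free when `K•` is strictly perfect and `R` is local (finite projective over a local ring).
[cite: MumfordAV1970, §5 Lemma 1 (p. 47)] [cite: BrunsHerzog1998, §1.3 (pp. 16–17)] -/
theorem free_baseChangeComplex_X [IsLocalRing R] (hK : ∀ n, Module.Finite A₀ (K.X n) ∧ Module.Projective A₀ (K.X n)) (n : ℤ) :
    Module.Free R ((baseChangeComplex R K).X n) := by
  have h := finite_projective_baseChangeComplex_X R K hK n
  haveI := h.1
  haveI := h.2
  exact Module.free_of_flat_of_isLocalRing

/-- `R ⊗ K•` vanishes below degree `a` when `K•` does. [cite: MumfordAV1970, §5 Lemma 2 (p. 49)] -/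
theorem subsingleton_baseChangeComplex_X_of_lt (a : ℤ) [K.IsStrictlyGE a] (i : ℤ) (hi : i < a) :
    Subsingleton ((baseChangeComplex R K).X i) := by
  haveI : Subsingleton (K.X i) := ModuleCat.subsingleton_of_isZero (K.isZero_of_isStrictlyGE a i hi)
  exact inferInstanceAs (Subsingleton (R ⊗[A₀] K.X i))

/-- `R ⊗ K•` vanishes above degree `b` when `K•` does. [cite: MumfordAV1970, §5 Lemma 2 (p. 49)] -/
theorem subsingleton_baseChangeComplex_X_of_gt (b : ℤ) [K.IsStrictlyLE b] (i : ℤ) (hi : b < i) :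
    Subsingleton ((baseChangeComplex R K).X i) := by
  haveI : Subsingleton (K.X i) := ModuleCat.subsingleton_of_isZero (K.isZero_of_isStrictlyLE b i hi)
  exact inferInstanceAs (Subsingleton (R ⊗[A₀] K.X i))

/-! ## §2 The top differential after base change is onto -/

/-- **`d^g ⊗ R` is onto when `K• ⥲ C•` with `C•` flat and zero above `g`** (and `K•` zero above `g+1`): `H^{g+1}(R ⊗ K•) ≅ H^{g+1}(R ⊗ C•) = 0`
(Mumford §5 Lemma 2, ★ `quasiIso_tensorLeft_map_of_flat`) and `R ⊗ K^{g+2} = 0`.  For the Grothendieck complex of a `(g+1)`-member affine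
cover (`C• = Č•`, ★ `isStrictlyLE_cechComplex (r := g)`) this is the surjectivity hypothesis of ★ `homComplex_exactAt_of_surjective_d_top`.
[cite: MumfordAV1970, §5 Lemma 2 (p. 49)] [cite: Weibel1994, 1.2.7 (p. 9)] -/
theorem surjective_baseChangeComplex_d_of_quasiIso {C : CochainComplex (ModuleCat.{u} A₀) ℤ} (ψ : K ⟶ C) [QuasiIso ψ]
    (hK : ∀ n, Module.Finite A₀ (K.X n) ∧ Module.Projective A₀ (K.X n)) (hC : ∀ n, Module.Flat A₀ (C.X n)) (g : ℤ)
    [K.IsStrictlyLE (g + 1)] [C.IsStrictlyLE g] : Function.Surjective ((baseChangeComplex R K).d g (g + 1)).hom := by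
  have hKf := flat_X_of_finite_projective hK
  haveI : C.IsStrictlyLE (g + 1) := C.isStrictlyLE_of_le g (g + 1) (by omega)
  let TK := ((tensorLeft (ModuleCat.of A₀ R)).mapHomologicalComplex (ComplexShape.up ℤ)).obj K
  let TC := ((tensorLeft (ModuleCat.of A₀ R)).mapHomologicalComplex (ComplexShape.up ℤ)).obj C
  let F : TK ⟶ TC := ((tensorLeft (ModuleCat.of A₀ R)).mapHomologicalComplex (ComplexShape.up ℤ)).map ψ
  haveI : QuasiIso F := quasiIso_tensorLeft_map_of_flat ψ hKf hC (g + 1) (ModuleCat.of A₀ R)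
  have hC1 : Subsingleton (C.X (g + 1)) := ModuleCat.subsingleton_of_isZero (C.isZero_of_isStrictlyLE g (g + 1) (by omega))
  have hK2 : Subsingleton (K.X (g + 2)) := ModuleCat.subsingleton_of_isZero (K.isZero_of_isStrictlyLE (g + 1) (g + 2) (by omega))
  haveI : Subsingleton (TC.X (g + 1)) := inferInstanceAs (Subsingleton (R ⊗[A₀] C.X (g + 1)))
  haveI : Subsingleton (TK.X (g + 2)) := inferInstanceAs (Subsingleton (R ⊗[A₀] K.X (g + 2)))
  have hC2 : Subsingleton (C.X (g + 2)) := ModuleCat.subsingleton_of_isZero (C.isZero_of_isStrictlyLE g (g + 2) (by omega))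
  haveI : Subsingleton (TC.X (g + 2)) := inferInstanceAs (Subsingleton (R ⊗[A₀] C.X (g + 2)))
  have hexC : TC.ExactAt (g + 1) := by
    rw [exactAt_iff_function_exact TC g (g + 1) (g + 2) rfl (by omega)]
    intro y
    exact ⟨fun _ => ⟨0, Subsingleton.elim _ _⟩, fun _ => Subsingleton.elim _ _⟩
  have hexK := (exactAt_iff_of_quasiIsoAt F (g + 1)).2 hexC
  rw [exactAt_iff_function_exact TK g (g + 1) (g + 2) rfl (by omega)] at hexK
  intro y
  obtain ⟨x, hx⟩ := (hexK y).1 (Subsingleton.elim _ _)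
  refine ⟨x, ?_⟩
  rw [tensorLeft_d_hom_apply] at hx
  rw [baseChangeComplex_d_hom]
  exact hx

/-! ## §3 `Hom_R(R ⊗ K•, R)` is exact in degrees `[-g, 0)` -/

/-- **`h₂` FROM POWER-TORSION.**  Let `K•` be strictly perfect over `A₀` (finite projective terms), concentrated in degrees `[0, g+1]`; `R` a
LOCAL `A₀`-algebra with a weakly regular sequence `rs` of length `≥ g`; assume `d^g ⊗ R` is onto (§2) and that every `r ∈ rs` acts locally
nilpotently on every cohomology module of `R ⊗ K•` (each cocycle `z` has `r^k z` a coboundary — ★ B4 + ★ J4 for the Poincaré family).  Then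
`Hom_R(R ⊗ K•, R)` is exact at every degree `-g ≤ p < 0` (★ B1 makes `R ⊗ K•` exact below `g`; ★ (R1) dualises through `τ_{≤ g}` and ★ B2).
[cite: MumfordAV1970, §13 (pp. 125–130)] [cite: PeskineSzpiro1973, Lemme (1.8)] [cite: BrunsHerzog1998, §1.3 (pp. 16–17)] -/
theorem homComplex_baseChangeComplex_exactAt_of_torsion [IsLocalRing R]
    (hK : ∀ n, Module.Finite A₀ (K.X n) ∧ Module.Projective A₀ (K.X n)) (g : ℤ) [K.IsStrictlyGE 0] [K.IsStrictlyLE (g + 1)]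
    (rs : List R) (hrs : IsWeaklyRegular R rs) (hlen : g ≤ rs.length)
    (hd : Function.Surjective ((baseChangeComplex R K).d g (g + 1)).hom)
    (hnil : ∀ r ∈ rs, ∀ (i j l : ℤ), i + 1 = j → j + 1 = l → ∀ z : (baseChangeComplex R K).X j,
      ((baseChangeComplex R K).d j l).hom z = 0 → ∃ (k : ℕ) (w : (baseChangeComplex R K).X i), r ^ k • z = ((baseChangeComplex R K).d i j).hom w)
    (p : ℤ) (hp : p < 0) (hpg : -g ≤ p) : (homComplex (baseChangeComplex R K) R).ExactAt p := by
  have hfree := free_baseChangeComplex_X R K hK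
  have hfin : ∀ n, Module.Finite R ((baseChangeComplex R K).X n) := fun n => (finite_projective_baseChangeComplex_X R K hK n).1
  have hex : ∀ j, j < g → (baseChangeComplex R K).ExactAt j := fun j hj =>
    exactAt_of_isWeaklyRegular_of_flat_of_locallyNilpotent (baseChangeComplex R K) rs hrs 0
      (fun i hi => subsingleton_baseChangeComplex_X_of_lt R K 0 i hi)
      (fun i => by haveI := (finite_projective_baseChangeComplex_X R K hK i).2; infer_instance) hnil j (by omega)
  exact homComplex_exactAt_of_surjective_d_top (baseChangeComplex R K) g rs hrs hlen hfree hfin hd hex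
    (fun r hr i hi x hx => hnil r hr i g (g + 1) hi rfl x hx) p hp hpg

/-! ## §4 The entry point, wired -/

/-- **`dim_k H¹(k ⊗_R (R ⊗_{A₀} K•)) = dim_k 𝔪_R/𝔪_R²` FROM POWER-TORSION AND THE DEGREE-`≤ 1` DATA** ([MumfordAV1970] §13, the local count
«`dim H¹ = g`», duality-free).  Under the hypotheses of `homComplex_baseChangeComplex_exactAt_of_torsion` with `g ≥ 1` and `R` noetherian, given
`ε : Hom_R(R ⊗ K⁰, R) ↠ k` with `ker ε = im((d⁰¹ ⊗ R)^∨)` (★ `exists_residueField_surjective_exact_lcomp_baseChange_grothendieckComplex` for the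
Poincaré family), the degree-one cohomology of `k ⊗_R (R ⊗_{A₀} K•)` (map-`mkQ` spelling of the entry point) has `k`-dimension `dim_k 𝔪_R/𝔪_R²` —
`= g = dim A` when `R = 𝒪_{Â,0̂}` is regular of dimension `g` (★ `finrank_cotangentSpace_stalk_eq_of_isClosed`).
[cite: MumfordAV1970, §13 (pp. 125–130)] [cite: BrunsHerzog1998, §1.3 (pp. 16–17)] [cite: PeskineSzpiro1973, Lemme (1.8)] -/
theorem finrank_HOne_baseChangeComplex_residueField_eq_of_torsion [IsLocalRing R] [IsNoetherianRing R]
    (hK : ∀ n, Module.Finite A₀ (K.X n) ∧ Module.Projective A₀ (K.X n)) (g : ℤ) (hg : 1 ≤ g) [K.IsStrictlyGE 0] [K.IsStrictlyLE (g + 1)]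
    (rs : List R) (hrs : IsWeaklyRegular R rs) (hlen : g ≤ rs.length)
    (hd : Function.Surjective ((baseChangeComplex R K).d g (g + 1)).hom)
    (hnil : ∀ r ∈ rs, ∀ (i j l : ℤ), i + 1 = j → j + 1 = l → ∀ z : (baseChangeComplex R K).X j,
      ((baseChangeComplex R K).d j l).hom z = 0 → ∃ (k : ℕ) (w : (baseChangeComplex R K).X i), r ^ k • z = ((baseChangeComplex R K).d i j).hom w)
    (ε : ((baseChangeComplex R K).X 0 →ₗ[R] R) →ₗ[R] ResidueField R) (hε : Function.Surjective ε)
    (h₁ : Function.Exact (LinearMap.lcomp R R ((baseChangeComplex R K).d 0 1).hom) ε) :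
    Module.finrank (ResidueField R)
        ↥((LinearMap.ker ((baseChangeComplex (ResidueField R) (baseChangeComplex R K)).d 1 2).hom).map
          (LinearMap.range ((baseChangeComplex (ResidueField R) (baseChangeComplex R K)).d 0 1).hom).mkQ) =
      Module.finrank (ResidueField R) (CotangentSpace R) :=
  finrank_HOne_baseChangeComplex_residueField_eq_finrank_cotangentSpace (baseChangeComplex R K) (free_baseChangeComplex_X R K hK)
    (fun n => (finite_projective_baseChangeComplex_X R K hK n).1) ε hε h₁
    (homComplex_baseChangeComplex_exactAt_of_torsion R K hK g rs hrs hlen hd hnil (-1) (by omega) (by omega))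

end Literature.Algebra.Homology

end
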